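import Summits.AtomisticToContinuum.HydrodynamicLimit.Theorems.RelayRaceLocalityNearConstantShortTimeHLGeneralFamilyConcentrationRatio
import Summits.AtomisticToContinuum.HydrodynamicLimit.Theorems.ImplosionDichotomyPolynomialCompressionEosUniformGas
import Mathlib.Analysis.SpecialFunctions.Choose
import HarnessLib

/-!
# General `(ε_N, n_N)` families of the canonical hard-sphere gas, II: the cluster limit and the convergence of the
insertion ratios

Support file for the crux `…Theses.RelayRaceLocality.NearConstantShortTimeHL` (stmt-AtomisticToContinuum-12502),
line `means-pin-entropy`, registered stub `stub_concentrationGeneralFamilies : GeneralFamilyConcentration`.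
Along a GENERAL family `(ε_N, n_N)` with `ε_N > 0`, `ε_N → 0`, `n_N ε_N³ → σ³`:

* `gf_tendsto_choose_mul_pow`, `gf_tendsto_atTop`, `gf_tendsto_sub_mul`, `gf_tendsto_coef` — the cluster limit of
  the coefficients `C(n_N - 1 - s, j) W^g_{ε_N,n_N}(j+1) → γ_j ∫ g β^{j+1} = coefLim P σ g j` (the exact scaling identity
  `Wd_self_eq_pow_mul` of the tree, dominated convergence `tendsto_integral_Jint`, and `C(m_N, j) ε_N^{3j} → σ^{3j}/j!`
  for any `m_N → ∞` with `m_N ε_N³ → σ³`);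
* `gf_eventually_small` — eventually `ε_N < 1/2` and `n_N p_{ε_N} ≤ λ` for any slack `λ > ovDensity P σ`;
* the two-scale contraction argument of `HardSphereEulerRatio` (`SmallDensity.tendsto_qN_sub`) re-run along the
  family for a profile in the statics regime `SmallDensity P σ` with slack `ovDensity P σ < λ`, `2eλ ≤ 1/14`:
  `gf_eventually_abs_q_sub_le_step`, `gf_tendsto_q_sub` (`Ξ(n_N-1-l)/Ξ(n_N-l) → R(σ) = ratioLimit P σ`, the SAME
  limit ratio as along the conjunct scaling; the elementary `|q - R| ≤ 4|q⁻¹ - R⁻¹|` is the tree's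
  `EosUniformGas.abs_sub_le_four_mul_abs_inv_sub_inv`) and `gf_tendsto_r` (`Ξ(n_N-s-j)/Ξ(n_N-s) → R(σ)ʲ` for all fixed
  `s, j`; registered helper `gf_helper_ratios`).

No definitions. Sources: E. Pulvirenti – D. Tsagkarogiannis, Comm. Math. Phys. 316 (2012) Thm 2.1, §5;
H. Spohn, Large Scale Dynamics of Interacting Particles (1991), Part I §2.3.
-/

noncomputable section

namespace Summit.AtomisticToContinuum.HydrodynamicLimit.Theorems.NearConstantShortTimeHL

open MeasureTheory ProbabilityTheory Finset Filter Topology Asymptotics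
open scoped ENNReal
open Literature.MathematicalPhysics.KineticTheory Literature.MathematicalPhysics.StatisticalMechanics
open Literature.Probability.LatticeModels

/-! ### The cluster limit of the coefficients along a general family -/

/-- **The combinatorial prefactor along a general family**: if `m_N → ∞` and `m_N p_N → r` then
`C(m_N, k) p_Nᵏ → rᵏ/k!` (`C(m, k) ~ mᵏ/k!`, Mathlib's `isEquivalent_choose`). [folklore] -/
theorem gf_tendsto_choose_mul_pow {m : ℕ → ℕ} {p : ℕ → ℝ} {r : ℝ} (k : ℕ) (hm : Tendsto m atTop atTop)
    (hr : Tendsto (fun N => (m N : ℝ) * p N) atTop (𝓝 r)) :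
    Tendsto (fun N => ((m N).choose k : ℝ) * p N ^ k) atTop (𝓝 (r ^ k / k.factorial)) := by
  have h1 : (fun N => ((m N).choose k : ℝ)) ~[atTop] fun N => ((m N : ℝ) ^ k / k.factorial) :=
    (isEquivalent_choose k).comp_tendsto hm
  have h2 : (fun N => ((m N).choose k : ℝ) * p N ^ k) ~[atTop]
      fun N => ((m N : ℝ) * p N) ^ k / k.factorial := by
    have h3 := h1.mul (IsEquivalent.refl (u := fun N => p N ^ k))
    refine h3.trans (EventuallyEq.isEquivalent (Eventually.of_forall fun N => ?_))
    simp only [Pi.mul_apply]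
    rw [mul_pow]; ring
  refine (IsEquivalent.tendsto_nhds_iff h2).mpr ?_
  simpa [div_eq_mul_inv] using (hr.pow k).mul_const ((k.factorial : ℝ)⁻¹)

section ClusterLimit

variable (P : DensityProfile) {σ : ℝ} {ε : ℕ → ℝ} {n : ℕ → ℕ}

/-- **The particle number diverges** along a general family: `ε_N > 0`, `ε_N → 0`, `n_N ε_N³ → σ³ > 0` force
`n_N → ∞`. [folklore] -/
theorem gf_tendsto_atTop (hσ : 0 < σ) (hε0 : ∀ N, 0 < ε N) (hε : Tendsto ε atTop (𝓝 0))
    (hn : Tendsto (fun N => (n N : ℝ) * ε N ^ 3) atTop (𝓝 (σ ^ 3))) : Tendsto n atTop atTop := by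
  have h3 : Tendsto (fun N => ε N ^ 3) atTop (𝓝[>] 0) := by
    refine tendsto_nhdsWithin_iff.mpr ⟨?_, Eventually.of_forall fun N => pow_pos (hε0 N) 3⟩
    simpa using hε.pow 3
  have hinv : Tendsto (fun N => (ε N ^ 3)⁻¹) atTop atTop := tendsto_inv_nhdsGT_zero.comp h3
  have hprod := hn.pos_mul_atTop (pow_pos hσ 3) hinv
  refine (tendsto_natCast_atTop_iff (R := ℝ)).mp (hprod.congr fun N => ?_)
  exact mul_inv_cancel_right₀ (pow_ne_zero 3 (hε0 N).ne') _

/-- Shifted particle numbers still carry the packing: `(n_N - t) ε_N³ → σ³` for every fixed `t`. [folklore] -/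
theorem gf_tendsto_sub_mul (hσ : 0 < σ) (hε0 : ∀ N, 0 < ε N) (hε : Tendsto ε atTop (𝓝 0))
    (hn : Tendsto (fun N => (n N : ℝ) * ε N ^ 3) atTop (𝓝 (σ ^ 3))) (t : ℕ) :
    Tendsto (fun N => ((n N - t : ℕ) : ℝ) * ε N ^ 3) atTop (𝓝 (σ ^ 3)) := by
  have hnat := gf_tendsto_atTop hσ hε0 hε hn
  have h0 : Tendsto (fun N => (t : ℝ) * ε N ^ 3) atTop (𝓝 0) := by
    simpa using (hε.pow 3).const_mul (t : ℝ)
  have h := hn.sub h0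
  rw [sub_zero] at h
  refine h.congr' ?_
  filter_upwards [hnat.eventually_ge_atTop t] with N hN
  rw [Nat.cast_sub hN]
  ring

/-- **The cluster limit along a general family**: for `σ > 0`, bounded measurable `g`, every shift `s` and every
`j`, `C(n_N - 1 - s, j) · W^g_{ε_N, n_N}(j+1) → γ_j ∫ g β^{j+1} = coefLim P σ g j` whenever `ε_N > 0`, `ε_N → 0`,
`n_N ε_N³ → σ³` (exact scaling identity for `j ε_N < 1/4`, dominated convergence, and
`gf_tendsto_choose_mul_pow`). [folklore] -/
theorem gf_tendsto_coef :
    ∀ (P : Literature.MathematicalPhysics.KineticTheory.DensityProfile) {σ : ℝ} {ε : ℕ → ℝ} {n : ℕ → ℕ}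
      [∀ N, NeZero (n N)], 0 < σ → (∀ N, 0 < ε N) → Filter.Tendsto ε Filter.atTop (nhds 0) →
      Filter.Tendsto (fun N => (n N : ℝ) * ε N ^ 3) Filter.atTop (nhds (σ ^ 3)) →
      ∀ (s j : ℕ) {g : Literature.MathematicalPhysics.KineticTheory.T3 → ℝ}, Measurable g → ∀ {C : ℝ},
      (∀ y, |g y| ≤ C) →
      Filter.Tendsto (fun N => (((n N - 1 - s).choose j : ℝ) *
          Literature.MathematicalPhysics.KineticTheory.Wd P (ε N) (n N) g (j + 1))) Filter.atTop
        (nhds (Literature.MathematicalPhysics.KineticTheory.coefLim P σ g j)) := by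
  intro P σ ε n _ hσ hε0 hε hn s j g hg C hgC
  have hnat := gf_tendsto_atTop hσ hε0 hε hn
  have hev : ∀ᶠ N in atTop, ((n N - 1 - s).choose j : ℝ) * Wd P (ε N) (n N) g (j + 1) =
      (((n N - 1 - s).choose j : ℝ) * ε N ^ (3 * j)) *
        ∫ y0 : T3, g y0 * P.β y0 * Jint P (ε N) j y0 := by
    have h1 : ∀ᶠ N in atTop, j + 1 ≤ n N := hnat.eventually_ge_atTop (j + 1)
    have h2 : ∀ᶠ N in atTop, (j : ℝ) * ε N < 1 / 4 := by
      have := hε.const_mul (j : ℝ)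
      rw [mul_zero] at this
      exact this.eventually (gt_mem_nhds (by norm_num))
    filter_upwards [h1, h2] with N hN1 hN2
    haveI : NeZero (j + 1) := ⟨Nat.succ_ne_zero _⟩
    rw [Wd_eq_Wd_self P _ hN1 hg, Wd_self_eq_pow_mul P (hε0 N) hN2 hg hgC, ← mul_assoc]
  refine Tendsto.congr' (EventuallyEq.symm hev) ?_
  have hm : Tendsto (fun N => n N - 1 - s) atTop atTop := by
    have h := tendsto_sub_atTop_nat (1 + s) |>.comp hnat
    refine h.congr fun N => ?_
    simp only [Function.comp_apply]
    omega
  have hr : Tendsto (fun N => ((n N - 1 - s : ℕ) : ℝ) * ε N ^ 3) atTop (𝓝 (σ ^ 3)) := by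
    have h := gf_tendsto_sub_mul hσ hε0 hε hn (1 + s)
    refine h.congr fun N => ?_
    rw [show n N - (1 + s) = n N - 1 - s by omega]
  have hpre := gf_tendsto_choose_mul_pow j hm hr
  have h := hpre.mul (tendsto_integral_Jint P j hε hg hgC)
  have heq : coefLim P σ g j = (σ ^ 3) ^ j / j.factorial * (bE j * ∫ y0 : T3, g y0 * P.β y0 ^ (j + 1)) := by
    rw [coefLim, clusterCoeff, mul_assoc]
  rw [heq]
  refine h.congr fun N => ?_
  rw [pow_mul]

end ClusterLimit

/-! ### Two more uniform bounds at a fixed scale -/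

section Bounds

variable {P : DensityProfile} {e lam : ℝ} {n : ℕ}
  (he : 0 ≤ e) (he2 : e < 1 / 2) (hnp : (n : ℝ) * pOv P e ≤ lam) (hlam1 : lam < 1)
include he he2 hnp hlam1

/-- `Ξ(m)/Ξ(m+1) ≤ 2` when moreover `λ ≤ 1/2`. [folklore] -/
theorem gf_q_le_two (hlam2 : lam ≤ 1 / 2) {m : ℕ} (hm : m < n) : Xi P e n m / Xi P e n (m + 1) ≤ 2 := by
  refine (gf_q_le he he2 hnp hlam1 hm).trans ?_
  rw [inv_le_comm₀ (by linarith) (by norm_num)]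
  linarith

end Bounds

/-! ### Convergence of the insertion ratios along a general family -/

section Convergence

variable {P : DensityProfile} {σ lam : ℝ} {ε : ℕ → ℝ} {n : ℕ → ℕ}

/-- **Eventually the uniform bounds apply**: along a general family, eventually `ε_N < 1/2` and
`n_N p_{ε_N} ≤ λ` (`n_N p_{ε_N} = M v₁ n_N ε_N³ → M v₁ σ³ = ovDensity P σ < λ`). [folklore] -/
theorem gf_eventually_small (hlamσ : ovDensity P σ < lam) (hε : Tendsto ε atTop (𝓝 0))
    (hn : Tendsto (fun N => (n N : ℝ) * ε N ^ 3) atTop (𝓝 (σ ^ 3))) :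
    ∀ᶠ N in atTop, ε N < 1 / 2 ∧ (n N : ℝ) * pOv P (ε N) ≤ lam := by
  have h1 : ∀ᶠ N in atTop, ε N < 1 / 2 := hε.eventually (gt_mem_nhds (by norm_num))
  have h2 : Tendsto (fun N => (n N : ℝ) * pOv P (ε N)) atTop (𝓝 (ovDensity P σ)) := by
    have h := hn.const_mul (P.M * v₁)
    rw [show P.M * v₁ * σ ^ 3 = ovDensity P σ by rw [ovDensity]] at h
    refine h.congr fun N => ?_
    rw [pOv]; ring
  have h3 : ∀ᶠ N in atTop, (n N : ℝ) * pOv P (ε N) ≤ lam :=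
    (h2.eventually (Iic_mem_nhds hlamσ)).mono fun N hN => hN
  exact h1.and h3

variable [∀ N, NeZero (n N)] (hP : SmallDensity P σ) (hlamσ : ovDensity P σ < lam)
  (hlam : 2 * Real.exp 1 * lam ≤ 1 / 14) (hε0 : ∀ N, 0 < ε N) (hε : Tendsto ε atTop (𝓝 0))
  (hn : Tendsto (fun N => (n N : ℝ) * ε N ^ 3) atTop (𝓝 (σ ^ 3)))
include hP hlamσ hlam hε0 hε hn

/-- **The improvement step.** If eventually (in `N`, for every fixed shift `l`) `|Ξ(n_N-1-l)/Ξ(n_N-l) - R| ≤ η`,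
then for every `J` and `τ > 0`, eventually `|Ξ(n_N-1-l)/Ξ(n_N-l) - R| ≤ 4 ((J+1) 2ᴶ τ + κ₊ η + 2 e θ₊^{J+1}/(1-θ₊))`.
[folklore] -/
theorem gf_eventually_abs_q_sub_le_step {η : ℝ} (hη : 0 ≤ η)
    (H : ∀ l : ℕ, ∀ᶠ N in atTop,
      |Xi P (ε N) (n N) (n N - 1 - l) / Xi P (ε N) (n N) (n N - 1 - l + 1) - ratioLimit P σ| ≤ η)
    (J : ℕ) {τ : ℝ} (hτ : 0 < τ) (l : ℕ) :
    ∀ᶠ N in atTop, |Xi P (ε N) (n N) (n N - 1 - l) / Xi P (ε N) (n N) (n N - 1 - l + 1) - ratioLimit P σ| ≤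
      4 * ((J + 1) * 2 ^ J * τ + (Real.exp 1 * (2 * Real.exp 1 * lam) / (1 - 2 * Real.exp 1 * lam) ^ 2) * η +
        2 * (Real.exp 1 * (2 * Real.exp 1 * lam) ^ (J + 1) / (1 - 2 * Real.exp 1 * lam))) := by
  have hnat := gf_tendsto_atTop hP.σ_pos hε0 hε hn
  -- the shifted ratios
  have h1 : ∀ᶠ N in atTop, ∀ i ∈ range J,
      |Xi P (ε N) (n N) (n N - 1 - l - 1 - i) / Xi P (ε N) (n N) (n N - 1 - l - 1 - i + 1) - ratioLimit P σ| ≤ η := by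
    rw [eventually_all_finset]
    intro i _
    refine (H (l + 1 + i)).mono fun N hN => ?_
    rwa [show n N - 1 - l - 1 - i = n N - 1 - (l + 1 + i) by omega]
  -- the coefficients
  have h2 : ∀ᶠ N in atTop, ∀ j ∈ range (J + 1),
      |(((n N - 1 - l).choose j : ℝ) * Wd P (ε N) (n N) (fun _ => 1) (j + 1)) - coefLim P σ (fun _ => 1) j| ≤ τ := by
    rw [eventually_all_finset]
    intro j _
    have h := gf_tendsto_coef P hP.σ_pos hε0 hε hn l j (g := fun _ => (1 : ℝ)) measurable_const (C := 1)
      (fun _ => by simp)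
    refine ((Metric.tendsto_nhds.mp h) τ hτ).mono fun N hN => ?_
    rw [Real.dist_eq] at hN
    exact hN.le
  have hlam0 : 0 ≤ lam := hP.ovDensity_nonneg.trans hlamσ.le
  obtain ⟨hθ1, hlam2, -, -⟩ := gf_slack_numerics hlam0 hlam
  have hlam1 : lam < 1 := by linarith
  have hR0 : 0 < ratioLimit P σ := hP.ratioLimit_pos
  have hR2 : ratioLimit P σ ≤ 2 := hP.ratioLimit_mem.2
  filter_upwards [h1, h2, hnat.eventually_ge_atTop (l + J + 2), gf_eventually_small hlamσ hε hn]
    with N hN1 hN2 hN3 ⟨hN4, hN5⟩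
  have hm : n N - 1 - l < n N := by omega
  have hq0 : 0 < Xi P (ε N) (n N) (n N - 1 - l) / Xi P (ε N) (n N) (n N - 1 - l + 1) :=
    one_pos.trans_le (gf_one_le_q (hε0 N).le hN4 hN5 hlam1 hm)
  have hq2 : Xi P (ε N) (n N) (n N - 1 - l) / Xi P (ε N) (n N) (n N - 1 - l + 1) ≤ 2 :=
    gf_q_le_two (hε0 N).le hN4 hN5 hlam1 hlam2 hm
  refine (EosUniformGas.abs_sub_le_four_mul_abs_inv_sub_inv hq0 hq2 hR0 hR2).trans ?_
  refine mul_le_mul_of_nonneg_left ?_ (by norm_num)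
  exact gf_abs_inv_q_sub_inv_le hP hlamσ.le hlam (hε0 N).le hN4 hN5 (by omega) hm hη hτ.le
    (fun i hi => hN1 i (mem_range.mpr hi)) (fun j hj => hN2 j (mem_range.mpr (Nat.lt_succ_of_le hj)))

/-- **Convergence of the insertion ratios along a general family**: `Ξ(n_N-1-l)/Ξ(n_N-l) → R(σ)` for every fixed
`l` (iterating the improvement step from the trivial bound `4`; contraction factor `4κ₊ < 1`). [folklore] -/
theorem gf_tendsto_q_sub (l : ℕ) :
    Tendsto (fun N => Xi P (ε N) (n N) (n N - 1 - l) / Xi P (ε N) (n N) (n N - 1 - l + 1)) atTop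
      (𝓝 (ratioLimit P σ)) := by
  have hnat := gf_tendsto_atTop hP.σ_pos hε0 hε hn
  have hlam0 : 0 ≤ lam := hP.ovDensity_nonneg.trans hlamσ.le
  obtain ⟨hθ1, hlam2, hA1, hκ0⟩ := gf_slack_numerics hlam0 hlam
  have hlam1 : lam < 1 := by linarith
  set θ := 2 * Real.exp 1 * lam with hθdef
  set κ := Real.exp 1 * θ / (1 - θ) ^ 2 with hκdef
  have hθ0 : 0 ≤ θ := by positivity
  have hA0 : 0 ≤ 4 * κ := by positivity
  have hR0 : 0 < ratioLimit P σ := hP.ratioLimit_pos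
  have hR2 : ratioLimit P σ ≤ 2 := hP.ratioLimit_mem.2
  have htl0 : ∀ J : ℕ, 0 ≤ Real.exp 1 * θ ^ (J + 1) / (1 - θ) := fun J =>
    div_nonneg (by positivity) (by linarith)
  -- the trivial initial bound
  have H0 : ∀ l : ℕ, ∀ᶠ N in atTop,
      |Xi P (ε N) (n N) (n N - 1 - l) / Xi P (ε N) (n N) (n N - 1 - l + 1) - ratioLimit P σ| ≤ 4 := by
    intro l
    filter_upwards [hnat.eventually_ge_atTop (l + 2), gf_eventually_small hlamσ hε hn] with N hN ⟨hN4, hN5⟩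
    have hm : n N - 1 - l < n N := by omega
    have hq0 := gf_one_le_q (P := P) (hε0 N).le hN4 hN5 hlam1 hm
    have hq2 := gf_q_le_two (P := P) (hε0 N).le hN4 hN5 hlam1 hlam2 hm
    rw [abs_le]; constructor <;> linarith
  -- iterating the improvement step
  have Hiter : ∀ (J : ℕ) {τ : ℝ}, 0 < τ → ∀ k : ℕ, ∀ l : ℕ, ∀ᶠ N in atTop,
      |Xi P (ε N) (n N) (n N - 1 - l) / Xi P (ε N) (n N) (n N - 1 - l + 1) - ratioLimit P σ| ≤
        (4 * κ) ^ k * 4 + 4 * ((J + 1) * 2 ^ J * τ + 2 * (Real.exp 1 * θ ^ (J + 1) / (1 - θ))) / (1 - 4 * κ) := by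
    intro J τ hτ k
    have hb : 0 ≤ 4 * ((J + 1) * 2 ^ J * τ + 2 * (Real.exp 1 * θ ^ (J + 1) / (1 - θ))) / (1 - 4 * κ) := by
      have := htl0 J
      exact div_nonneg (by positivity) (by linarith)
    induction k with
    | zero =>
        intro l
        refine (H0 l).mono fun N hN => hN.trans ?_
        rw [pow_zero, one_mul]
        linarith
    | succ k ih =>
        intro l
        have hηk : 0 ≤ (4 * κ) ^ k * 4 +
            4 * ((J + 1) * 2 ^ J * τ + 2 * (Real.exp 1 * θ ^ (J + 1) / (1 - θ))) / (1 - 4 * κ) := by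
          positivity
        refine (gf_eventually_abs_q_sub_le_step hP hlamσ hlam hε0 hε hn hηk ih J hτ l).mono fun N hN => ?_
        refine hN.trans (le_of_eq ?_)
        have h1A : (1 - 4 * κ) ≠ 0 := by linarith
        rw [← hθdef, ← hκdef]
        field_simp
        ring
  -- conclusion
  rw [Metric.tendsto_nhds]
  intro e he
  obtain ⟨δ₀, hδ₀⟩ : ∃ δ₀ : ℝ, δ₀ = e * (1 - 4 * κ) / 24 := ⟨_, rfl⟩
  have hδ₀pos : 0 < δ₀ := by rw [hδ₀]; exact div_pos (mul_pos he (by linarith)) (by norm_num)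
  have htail : Tendsto (fun J : ℕ => Real.exp 1 * θ ^ (J + 1) / (1 - θ)) atTop (𝓝 0) := by
    have h := (tendsto_pow_atTop_nhds_zero_of_lt_one hθ0 hθ1).comp (tendsto_add_atTop_nat 1)
    have h' := h.mul_const (Real.exp 1 / (1 - θ))
    rw [zero_mul] at h'
    refine h'.congr fun J => ?_
    simp only [Function.comp_apply]; ring
  obtain ⟨J, hJ⟩ := ((Metric.tendsto_nhds.mp htail) δ₀ hδ₀pos).exists
  rw [Real.dist_eq, sub_zero, abs_of_nonneg (htl0 J)] at hJ
  obtain ⟨τ, hτ_def⟩ : ∃ τ : ℝ, τ = δ₀ / ((J + 1) * 2 ^ J) := ⟨_, rfl⟩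
  have hJpos : (0 : ℝ) < (J + 1) * 2 ^ J := by positivity
  have hτpos : 0 < τ := by rw [hτ_def]; exact div_pos hδ₀pos hJpos
  have hτeq : (J + 1) * 2 ^ J * τ = δ₀ := by rw [hτ_def]; field_simp
  obtain ⟨k, hk⟩ := exists_pow_lt_of_lt_one (show 0 < e / 8 by positivity) hA1
  filter_upwards [Hiter J hτpos k l] with N hN
  rw [Real.dist_eq]
  refine lt_of_le_of_lt hN ?_
  rw [hτeq]
  have h1 : (4 * κ) ^ k * 4 < e / 2 := by
    rw [hκdef, hθdef] at *
    rw [lt_div_iff₀ (by norm_num : (0 : ℝ) < 8)] at hk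
    linarith
  have h2 : 4 * (δ₀ + 2 * (Real.exp 1 * θ ^ (J + 1) / (1 - θ))) / (1 - 4 * κ) ≤ e / 2 := by
    rw [div_le_iff₀ (by linarith)]
    have : 4 * (δ₀ + 2 * (Real.exp 1 * θ ^ (J + 1) / (1 - θ))) ≤ 12 * δ₀ := by linarith
    refine this.trans (le_of_eq ?_)
    rw [hδ₀]; ring
  linarith

/-- **Convergence of the products of ratios along a general family**: `Ξ(n_N-s-j)/Ξ(n_N-s) → R(σ)ʲ` for all fixed
`s, j`. [folklore] -/
theorem gf_tendsto_r (s j : ℕ) :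
    Tendsto (fun N => Xi P (ε N) (n N) (n N - s - j) / Xi P (ε N) (n N) (n N - s)) atTop
      (𝓝 (ratioLimit P σ ^ j)) := by
  have hnat := gf_tendsto_atTop hP.σ_pos hε0 hε hn
  have hlam0 : 0 ≤ lam := hP.ovDensity_nonneg.trans hlamσ.le
  obtain ⟨-, hlam2, -, -⟩ := gf_slack_numerics hlam0 hlam
  have hlam1 : lam < 1 := by linarith
  induction j with
  | zero =>
      simp_rw [pow_zero]
      refine tendsto_const_nhds.congr' ?_
      filter_upwards [gf_eventually_small hlamσ hε hn] with N ⟨hN4, hN5⟩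
      exact (gf_r_zero (hε0 N).le hN4 hN5 hlam1 (Nat.sub_le (n N) s)).symm
  | succ j ih =>
      have hmul := ih.mul (gf_tendsto_q_sub hP hlamσ hlam hε0 hε hn (s + j))
      rw [← pow_succ] at hmul
      refine hmul.congr' ?_
      filter_upwards [hnat.eventually_ge_atTop (s + j + 1), gf_eventually_small hlamσ hε hn] with N hN ⟨hN4, hN5⟩
      rw [gf_r_succ (hε0 N).le hN4 hN5 hlam1 (Nat.sub_le (n N) s) (by omega),
        show n N - s - 1 - j = n N - 1 - (s + j) by omega]

end Convergence

/-! ### Registered helper -/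

/-- **Registered helper `gf_helper_ratios`** (sub-goal of `stub_concentrationGeneralFamilies`): convergence of the
products of insertion ratios along a general family, `gf_tendsto_r` in closed form. [folklore] -/
theorem gf_helper_ratios :
    ∀ {P : Literature.MathematicalPhysics.KineticTheory.DensityProfile} {σ lam : ℝ} {ε : ℕ → ℝ} {n : ℕ → ℕ}
      [∀ N, NeZero (n N)], Literature.MathematicalPhysics.KineticTheory.SmallDensity P σ →
      Literature.MathematicalPhysics.KineticTheory.ovDensity P σ < lam → 2 * Real.exp 1 * lam ≤ 1 / 14 →
      (∀ N, 0 < ε N) → Filter.Tendsto ε Filter.atTop (nhds 0) →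
      Filter.Tendsto (fun N => (n N : ℝ) * ε N ^ 3) Filter.atTop (nhds (σ ^ 3)) → ∀ (s j : ℕ),
      Filter.Tendsto (fun N => Literature.MathematicalPhysics.KineticTheory.Xi P (ε N) (n N) (n N - s - j) /
          Literature.MathematicalPhysics.KineticTheory.Xi P (ε N) (n N) (n N - s)) Filter.atTop
        (nhds (Literature.MathematicalPhysics.KineticTheory.ratioLimit P σ ^ j)) :=
  fun hP hlamσ hlam hε0 hε hn s j => gf_tendsto_r hP hlamσ hlam hε0 hε hn s j

end Summit.AtomisticToContinuum.HydrodynamicLimit.Theorems.NearConstantShortTimeHL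

end
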